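import Literature.AlgebraicGeometry.HodgeTheory.ChernCharacterBettiLaws
import Literature.AlgebraicGeometry.Modules.DetClassTensor
import Literature.AlgebraicGeometry.Modules.RankOneTensorDualCancel
import Literature.AlgebraicGeometry.Modules.DetClassDual
import HarnessLib

/-!
# The tensor law for `ch₁` on line bundles, from the topological laws: `ch₁(L ⊗ L′) = ch₁(L) + ch₁(L′)`

Family `hodge`, layer `Literature/AlgebraicGeometry/HodgeTheory`. HONEST FRAMING: nothing here constructs a Chern character or bears
on any case of the Hodge conjecture; `ChernCharacterBetti` stays a hypothesis structure without an instance. Sequel to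
`HodgeTheory/ChernCharacterLawsRigidity` (the tautological classes `t_a(ch) = ch₁(𝒪_{ℙᵃ}(-1))` and the LINE BUNDLE FORMULA
`ch₁(L) = ψ^* t_a − φ^* t_a` whenever `[L]·[φ^*𝒪(-1)] = [ψ^*𝒪(-1)]`, for any raw datum with isomorphism invariance, functoriality and
`chᵢ(𝒪^I) = 0` for `i > 0`).

The structure `ChernCharacterBetti` (Fulton's laws as typed in the tree) has NO tensor law; this file DERIVES the degree-one tensor law
for line bundles on smooth projective varieties from three of the nine topological laws:

* §1 `ch_serreTwist_segreEmbedding_one_eq` — **the universal case**: on `ℙᵃ ×_ℂ ℙᵇ`, for the Segre embedding `σ : ℙᵃ × ℙᵇ ↪ ℙᴷ`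
  (`K = ab + a + b`), `ch₁(σ^*𝒪(-1)) = p₁^* t_a + p₂^* t_b` — Künneth in degree `2` (`exists_eq_map_fst_add_map_snd_projectiveSpaces`)
  and the two slices `ℙᵃ × {pt}`, `{pt} × ℙᵇ`, on which `σ^*𝒪(-1)` restricts to `𝒪(-1)` (Segre product formula for the classes of
  Serre twists, `detClass_serreTwist_segre`; twists along constant maps are trivial); `map_ch_serreTwist_one_eq` — `f^* t_K = ch₁(f^*𝒪_{ℙᴷ}(-1))`
  (`= ch₁(serreTwist f 1)`) for every `f : X ⟶ ℙᴷ`.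
* §2 `ch_one_tensorObj_eq_add_of_laws` — **`ch₁(L₁ ⊗ L₂) = ch₁(L₁) + ch₁(L₂)` for modules `L₁`, `L₂` of rank one on a smooth projective
  `X`**: present `Lᵢ` as `[Lᵢ]·[φᵢ^*𝒪(-1)] = [ψᵢ^*𝒪(-1)]` (`LineBundleClassEqDifferenceOfPullbacks_holds`, Hartshorne II 7.1 ∕ 7.6), so that
  `L₁ ⊗ L₂` is presented by the Segre composites `Φ = σ ∘ (φ₁, φ₂)`, `Ψ = σ ∘ (ψ₁, ψ₂)` (`[det (L₁ ⊗ L₂)] = [L₁][L₂]`,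
  `detClass_tensorObj_of_hasRank_one`; Segre product formula), and read the line bundle formula through §1;
  `ChernDatum.IsTopological.ch_one_tensorObj_eq_add` — the bundled form; `ch_tensorObj_eq_of_hasRank_one_of_laws` — all degrees:
  `chᵢ(L₁ ⊗ L₂) = (i!)⁻¹ (ch₁ L₁ + ch₁ L₂)ⁱ` by the exponential law.
* §3 `ch_one_dual_eq_neg_of_laws` ∕ `ChernDatum.IsTopological.ch_one_dual_eq_neg` — the dual law `ch₁(L^∨) = −ch₁(L)`
  (`𝒪 ≅ L^∨ ⊗ L`, `Modules/RankOneTensorDualCancel`).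

In print: Fulton §15.1 (iii) «`ch[L] = exp(c₁(L))`» with Example 3.2.3 ∕ Prop. 2.5 (e) «`c₁(L ⊗ L′) = c₁(L) + c₁(L′)`»; Hartshorne II
Ex. 5.11–5.12 (Segre: `σ^*𝒪(1) ≅ p₁^*𝒪(1) ⊗ p₂^*𝒪(1)`). Everything is proved; no definition, no named fact, no instance, no notation.

## References

* [Fulton1998] W. Fulton, Intersection Theory, 2nd ed. (1998): §15.1 (ii)–(iii), Example 3.2.3, Prop. 2.5 (e).
* [Hartshorne1977] R. Hartshorne, Algebraic Geometry (1977): II Ex. 5.11, II Prop. 5.12 (b)–(c), II Thm. 7.1, II Thm. 7.6, II Ex. 6.11,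
  III Ex. 4.5.
* [HatcherAT2002] A. Hatcher, Algebraic Topology (2002): §3.2 Thm. 3.16 (Künneth), Thm. 3.19.
* [Grothendieck1958] A. Grothendieck, La théorie des classes de Chern (1958): Thm. 1.
* Tree: `HodgeTheory/ChernCharacterLawsRigidity`, `HodgeTheory/ChernCharacterBettiUniqueness` (`exists_eq_map_fst_add_map_snd_projectiveSpaces`,
  `detClass_serreTwist_toSpecOver_comp`, `LineBundleClassEqDifferenceOfPullbacks_holds`), `Modules/SerreTwistSegreClass`, `Modules/DetClassTensor`.
-/

noncomputable section

open CategoryTheory CategoryTheory.Limits AlgebraicGeometry MonoidalCategory CartesianMonoidalCategory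
open Literature.AlgebraicTopology.SingularHomology
open Literature.AlgebraicGeometry.Morphisms.ProjCech (PP)
open Literature.AlgebraicGeometry.Modules.SerreTwist (serreTwist isFiniteLocallyFree_serreTwist hasRank_serreTwist
  detClass_serreTwist_comp detClass_serreTwist_segre)
open Literature.AlgebraicGeometry.Motives

namespace Literature.AlgebraicGeometry.HodgeTheory

section HodgeTheory

variable (ch : ∀ (X : SchemeOver ℂ) (E : X.left.Modules) (i : ℕ), complexBetti X (2 * i))

/-! ### §1 The universal case: `ch₁` of `σ^*𝒪(-1)` on `ℙᵃ × ℙᵇ` -/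

/-- **`f^* t_K(ch) = ch₁(f^*𝒪_{ℙᴷ}(-1)) = ch₁(serreTwist f 1)`** for every `f : X ⟶ ℙᴷ` over `ℂ`: functoriality, and the pulled-back
module is the Serre twist along `f` (rank-one modules with the same class in `Ȟ¹(X, 𝒪^×)` are isomorphic, III Ex. 4.5; `𝒪(n)` is
compatible with base change, II Prop. 5.12 (c)). [cite: Hartshorne1977, II Prop. 5.12 (c) and III Ex. 4.5] [cite: Fulton1998, §15.1 (ii)] -/
theorem map_ch_serreTwist_one_eq
    (h_congr : ∀ {X : SchemeOver ℂ} {E F : X.left.Modules} (_ : E ≅ F) (i : ℕ), ch X E i = ch X F i)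
    (h_map : ∀ {X Y : SchemeOver ℂ} (f : Y ⟶ X) (E : X.left.Modules), IsVectorBundle E →
      ∀ i : ℕ, complexBetti.map f (2 * i) (ch X E i) = ch Y ((Scheme.Modules.pullback f.left).obj E) i)
    {K : ℕ} {X : SchemeOver ℂ} (f : X ⟶ projectiveSpace K ℂ) :
    complexBetti.map f 2 (ch (projectiveSpace K ℂ)
        (serreTwist (𝟙 (projectiveSpace K ℂ).left : (projectiveSpace K ℂ).left ⟶ PP ℂ K) 1) 1) =
      ch X (serreTwist (f.left : X.left ⟶ PP ℂ K) 1) 1 := by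
  have hK := isFiniteLocallyFree_serreTwist (𝟙 (projectiveSpace K ℂ).left : (projectiveSpace K ℂ).left ⟶ PP ℂ K) 1
  obtain ⟨e⟩ := (Modules.nonempty_iso_iff_detClass_eq
      (Modules.hasRank_pullback f.left (hasRank_serreTwist _ 1)) (hasRank_serreTwist (f.left : X.left ⟶ PP ℂ K) 1)
      (hK.pullback f.left) (isFiniteLocallyFree_serreTwist _ 1)).2 (by
    rw [Modules.detClass_pullback f.left (hE := hK), ← detClass_serreTwist_comp]
    exact detClass_serreTwist_congr (Category.comp_id _) 1)
  have h := h_map f _ hK.isVectorBundle 1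
  rw [h_congr e 1] at h
  exact h

/-- **The universal tensor law**: on `ℙᵃ ×_ℂ ℙᵇ`, `ch₁(σ^*𝒪_{ℙᴷ}(-1)) = p₁^* t_a(ch) + p₂^* t_b(ch)` for the Segre embedding
`σ : ℙᵃ × ℙᵇ ↪ ℙᴷ`, `K = ab + a + b` (where `σ^*𝒪(-1) ≅ p₁^*𝒪(-1) ⊗ p₂^*𝒪(-1)`, II Ex. 5.11). By Künneth `ch₁(σ^*𝒪(-1)) = p₁^*α + p₂^*β`;
restricting to the slice `ℙᵃ × {pt}` (resp. `{pt} × ℙᵇ`), on which `σ^*𝒪(-1)` is `𝒪(-1)` and `p₂` (resp. `p₁`) is constant, gives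
`α = t_a` (resp. `β = t_b`). [cite: Hartshorne1977, II Ex. 5.11 (p. 125) and II Prop. 5.12 (b)–(c)] [cite: HatcherAT2002, §3.2 Thm. 3.16]
[cite: Fulton1998, §15.1 (ii)] -/
theorem ch_serreTwist_segreEmbedding_one_eq
    (h_congr : ∀ {X : SchemeOver ℂ} {E F : X.left.Modules} (_ : E ≅ F) (i : ℕ), ch X E i = ch X F i)
    (h_map : ∀ {X Y : SchemeOver ℂ} (f : Y ⟶ X) (E : X.left.Modules), IsVectorBundle E →
      ∀ i : ℕ, complexBetti.map f (2 * i) (ch X E i) = ch Y ((Scheme.Modules.pullback f.left).obj E) i)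
    (a b : ℕ) :
    ch (projectiveSpace a ℂ ⊗ projectiveSpace b ℂ)
        (serreTwist ((segreEmbedding a b ℂ).left :
          (projectiveSpace a ℂ ⊗ projectiveSpace b ℂ).left ⟶ PP ℂ (a * b + a + b)) 1) 1 =
      complexBetti.map (fst (projectiveSpace a ℂ) (projectiveSpace b ℂ)) 2
          (ch (projectiveSpace a ℂ)
            (serreTwist (𝟙 (projectiveSpace a ℂ).left : (projectiveSpace a ℂ).left ⟶ PP ℂ a) 1) 1) +
        complexBetti.map (snd (projectiveSpace a ℂ) (projectiveSpace b ℂ)) 2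
          (ch (projectiveSpace b ℂ)
            (serreTwist (𝟙 (projectiveSpace b ℂ).left : (projectiveSpace b ℂ).left ⟶ PP ℂ b) 1) 1) := by
  set S : (projectiveSpace a ℂ ⊗ projectiveSpace b ℂ).left ⟶ PP ℂ (a * b + a + b) := (segreEmbedding a b ℂ).left with hS
  obtain ⟨P⟩ := (isSmoothProjective_projectiveSpace_holds ℂ a).nonempty_algPoints ℂ
  obtain ⟨Q⟩ := (isSmoothProjective_projectiveSpace_holds ℂ b).nonempty_algPoints ℂ
  obtain ⟨α, β, hαβ⟩ := exists_eq_map_fst_add_map_snd_projectiveSpaces a b (ch _ (serreTwist S 1) 1)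
  have hM := isFiniteLocallyFree_serreTwist S 1
  -- the class of `σ^*𝒪(-1)` along a map `g` into the product: the Segre product formula
  have hseg : ∀ {Y : SchemeOver ℂ} (g : Y ⟶ projectiveSpace a ℂ ⊗ projectiveSpace b ℂ),
      Modules.detClass (hM.pullback g.left) =
        Modules.detClass (isFiniteLocallyFree_serreTwist ((g ≫ fst _ _).left : Y.left ⟶ PP ℂ a) 1) *
          Modules.detClass (isFiniteLocallyFree_serreTwist ((g ≫ snd _ _).left : Y.left ⟶ PP ℂ b) 1) := by
    intro Y g
    rw [Modules.detClass_pullback g.left (hE := hM), ← detClass_serreTwist_comp]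
    exact detClass_serreTwist_segre (segreIndexEquiv a b) g.left 1
  -- the slice `s₁ = (id, const_Q)`: `s₁^* σ^*𝒪(-1) ≅ 𝒪_{ℙᵃ}(-1)`, so `α = t_a`
  set s₁ : projectiveSpace a ℂ ⟶ projectiveSpace a ℂ ⊗ projectiveSpace b ℂ := lift (𝟙 _) (toSpecOver _ ≫ Q) with hs₁
  have h11 : ((s₁ ≫ fst _ _).left : (projectiveSpace a ℂ).left ⟶ PP ℂ a) = 𝟙 (projectiveSpace a ℂ).left := by
    rw [hs₁, lift_fst]; rfl
  have h12 : ((s₁ ≫ snd _ _).left : (projectiveSpace a ℂ).left ⟶ PP ℂ b) = (toSpecOver _ ≫ Q).left := by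
    rw [hs₁, lift_snd]
  obtain ⟨e₁⟩ := (Modules.nonempty_iso_iff_detClass_eq (Modules.hasRank_pullback s₁.left (hasRank_serreTwist S 1))
      (hasRank_serreTwist (𝟙 (projectiveSpace a ℂ).left : (projectiveSpace a ℂ).left ⟶ PP ℂ a) 1)
      (hM.pullback s₁.left) (isFiniteLocallyFree_serreTwist _ 1)).2 (by
    rw [hseg s₁, detClass_serreTwist_congr h11 1, detClass_serreTwist_congr h12 1, detClass_serreTwist_toSpecOver_comp,
      mul_one])
  have hα : ch (projectiveSpace a ℂ)
      (serreTwist (𝟙 (projectiveSpace a ℂ).left : (projectiveSpace a ℂ).left ⟶ PP ℂ a) 1) 1 = α := by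
    have h := h_map s₁ _ hM.isVectorBundle 1
    rw [h_congr e₁ 1, hαβ, map_add, complexBetti_map_map_apply, complexBetti_map_map_apply, lift_fst, lift_snd,
      complexBetti_map_toSpecOver_comp_eq_zero Q two_ne_zero, add_zero, complexBetti.map_id] at h
    exact h.symm
  -- the slice `s₂ = (const_P, id)`: `s₂^* σ^*𝒪(-1) ≅ 𝒪_{ℙᵇ}(-1)`, so `β = t_b`
  set s₂ : projectiveSpace b ℂ ⟶ projectiveSpace a ℂ ⊗ projectiveSpace b ℂ := lift (toSpecOver _ ≫ P) (𝟙 _) with hs₂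
  have h21 : ((s₂ ≫ fst _ _).left : (projectiveSpace b ℂ).left ⟶ PP ℂ a) = (toSpecOver _ ≫ P).left := by
    rw [hs₂, lift_fst]
  have h22 : ((s₂ ≫ snd _ _).left : (projectiveSpace b ℂ).left ⟶ PP ℂ b) = 𝟙 (projectiveSpace b ℂ).left := by
    rw [hs₂, lift_snd]; rfl
  obtain ⟨e₂⟩ := (Modules.nonempty_iso_iff_detClass_eq (Modules.hasRank_pullback s₂.left (hasRank_serreTwist S 1))
      (hasRank_serreTwist (𝟙 (projectiveSpace b ℂ).left : (projectiveSpace b ℂ).left ⟶ PP ℂ b) 1)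
      (hM.pullback s₂.left) (isFiniteLocallyFree_serreTwist _ 1)).2 (by
    rw [hseg s₂, detClass_serreTwist_congr h21 1, detClass_serreTwist_congr h22 1, detClass_serreTwist_toSpecOver_comp,
      one_mul])
  have hβ : ch (projectiveSpace b ℂ)
      (serreTwist (𝟙 (projectiveSpace b ℂ).left : (projectiveSpace b ℂ).left ⟶ PP ℂ b) 1) 1 = β := by
    have h := h_map s₂ _ hM.isVectorBundle 1
    rw [h_congr e₂ 1, hαβ, map_add, complexBetti_map_map_apply, complexBetti_map_map_apply, lift_fst, lift_snd,
      complexBetti_map_toSpecOver_comp_eq_zero P two_ne_zero, zero_add, complexBetti.map_id] at h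
    exact h.symm
  rw [hαβ, ← hα, ← hβ]

/-! ### §2 The tensor law on line bundles over a smooth projective variety -/

/-- **The tensor law for `ch₁`**: for modules `L₁`, `L₂` of rank one on a smooth projective complex variety and a raw datum with
isomorphism invariance, functoriality and `chᵢ(𝒪^I) = 0` (`i > 0`), **`ch₁(L₁ ⊗ L₂) = ch₁(L₁) + ch₁(L₂)`**. Presentations
`[Lᵢ]·[φᵢ^*𝒪(-1)] = [ψᵢ^*𝒪(-1)]` (II Thm. 7.1 ∕ 7.6) multiply to a presentation of `L₁ ⊗ L₂` by the Segre composites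
`Φ = σ ∘ (φ₁, φ₂)`, `Ψ = σ ∘ (ψ₁, ψ₂) : X ⟶ ℙᴷ` (`[det (L₁ ⊗ L₂)] = [L₁][L₂]`, II Ex. 6.11; Segre product formula, II Ex. 5.11); the line
bundle formula `ch₁ = Ψ^* t_K − Φ^* t_K` (`ch_one_eq_of_detClass_eq`) and the universal case `σ^* t_K = p₁^* t_a + p₂^* t_b` then give the
sum. [cite: Fulton1998, §15.1 (iii) and Example 3.2.3] [cite: Hartshorne1977, II Ex. 5.11, II Ex. 6.11, II Thm. 7.1 and III Ex. 4.5]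
[cite: Grothendieck1958, Thm. 1] -/
theorem ch_one_tensorObj_eq_add_of_laws
    (h_congr : ∀ {X : SchemeOver ℂ} {E F : X.left.Modules} (_ : E ≅ F) (i : ℕ), ch X E i = ch X F i)
    (h_map : ∀ {X Y : SchemeOver ℂ} (f : Y ⟶ X) (E : X.left.Modules), IsVectorBundle E →
      ∀ i : ℕ, complexBetti.map f (2 * i) (ch X E i) = ch Y ((Scheme.Modules.pullback f.left).obj E) i)
    (h_free : ∀ (X : SchemeOver ℂ) (I : Type) [Finite I] {i : ℕ}, 0 < i →
      ch X (SheafOfModules.free (R := X.left.ringCatSheaf) I) i = 0)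
    {n : ℕ} {X : SchemeOver ℂ} (hX : IsSmoothProjective n X) {L₁ L₂ : X.left.Modules} (hL₁ : HasRank L₁ 1)
    (hL₂ : HasRank L₂ 1) :
    ch X (Modules.tensorObj L₁ L₂) 1 = ch X L₁ 1 + ch X L₂ 1 := by
  obtain ⟨a, φ₁, ψ₁, -, hcl₁⟩ := LineBundleClassEqDifferenceOfPullbacks_holds n X hX L₁ hL₁
  obtain ⟨b, φ₂, ψ₂, -, hcl₂⟩ := LineBundleClassEqDifferenceOfPullbacks_holds n X hX L₂ hL₂
  -- notation
  set ta := ch (projectiveSpace a ℂ)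
    (serreTwist (𝟙 (projectiveSpace a ℂ).left : (projectiveSpace a ℂ).left ⟶ PP ℂ a) 1) 1 with hta
  set tb := ch (projectiveSpace b ℂ)
    (serreTwist (𝟙 (projectiveSpace b ℂ).left : (projectiveSpace b ℂ).left ⟶ PP ℂ b) 1) 1 with htb
  set tK := ch (projectiveSpace (a * b + a + b) ℂ)
    (serreTwist (𝟙 (projectiveSpace (a * b + a + b) ℂ).left :
      (projectiveSpace (a * b + a + b) ℂ).left ⟶ PP ℂ (a * b + a + b)) 1) 1 with htK
  set Φ : X ⟶ projectiveSpace (a * b + a + b) ℂ := lift φ₁ φ₂ ≫ segreEmbedding a b ℂ with hΦ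
  set Ψ : X ⟶ projectiveSpace (a * b + a + b) ℂ := lift ψ₁ ψ₂ ≫ segreEmbedding a b ℂ with hΨ
  -- Segre product formula for the classes of the twists along `Φ`, `Ψ`
  have hseg : ∀ (u v : X ⟶ projectiveSpace a ℂ) (u' v' : X ⟶ projectiveSpace b ℂ) (g : X ⟶ projectiveSpace a ℂ ⊗ projectiveSpace b ℂ),
      g = lift u u' → Modules.detClass (isFiniteLocallyFree_serreTwist
        ((g ≫ segreEmbedding a b ℂ).left : X.left ⟶ PP ℂ (a * b + a + b)) 1) =
      Modules.detClass (isFiniteLocallyFree_serreTwist (u.left : X.left ⟶ PP ℂ a) 1) *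
        Modules.detClass (isFiniteLocallyFree_serreTwist (u'.left : X.left ⟶ PP ℂ b) 1) := by
    rintro u - u' - g rfl
    have h := detClass_serreTwist_segre (segreIndexEquiv a b) (lift u u').left 1
    have h1 : (lift u u').left ≫ pullback.fst (Segre.toSpec (Fin (a + 1)) ℂ) (Segre.toSpec (Fin (b + 1)) ℂ) =
        (u.left : X.left ⟶ PP ℂ a) := by
      change (lift u u' ≫ fst _ _).left = _
      rw [lift_fst]
    have h2 : (lift u u').left ≫ pullback.snd (Segre.toSpec (Fin (a + 1)) ℂ) (Segre.toSpec (Fin (b + 1)) ℂ) =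
        (u'.left : X.left ⟶ PP ℂ b) := by
      change (lift u u' ≫ snd _ _).left = _
      rw [lift_snd]
    exact h.trans (congrArg₂ (· * ·) (detClass_serreTwist_congr h1 1) (detClass_serreTwist_congr h2 1))
  have hΦcl := hseg φ₁ φ₁ φ₂ φ₂ (lift φ₁ φ₂) rfl
  have hΨcl := hseg ψ₁ ψ₁ ψ₂ ψ₂ (lift ψ₁ ψ₂) rfl
  -- the presentation of `L₁ ⊗ L₂`
  have hL := Modules.hasRank_tensorObj_one hL₁ hL₂
  have hcl : Modules.detClass (Modules.HasRank.isFiniteLocallyFree' hL) *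
      Modules.detClass (isFiniteLocallyFree_serreTwist (Φ.left : X.left ⟶ PP ℂ (a * b + a + b)) 1) =
      Modules.detClass (isFiniteLocallyFree_serreTwist (Ψ.left : X.left ⟶ PP ℂ (a * b + a + b)) 1) := by
    rw [Modules.detClass_tensorObj_of_hasRank_one hL₁ hL₂ (Modules.HasRank.isFiniteLocallyFree' hL₁)
      (Modules.HasRank.isFiniteLocallyFree' hL₂), hΦcl, hΨcl, mul_mul_mul_comm, hcl₁, hcl₂]
  -- the line bundle formula for `L₁ ⊗ L₂`, `L₁`, `L₂`
  have hT := ch_one_eq_of_detClass_eq ch h_congr h_map h_free hL Φ Ψ hcl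
  have h1 := ch_one_eq_of_detClass_eq ch h_congr h_map h_free hL₁ φ₁ ψ₁ hcl₁
  have h2 := ch_one_eq_of_detClass_eq ch h_congr h_map h_free hL₂ φ₂ ψ₂ hcl₂
  -- `σ^* t_K = p₁^* t_a + p₂^* t_b`, hence `Ψ^* t_K = ψ₁^* t_a + ψ₂^* t_b` and the same for `Φ`
  have hσ : complexBetti.map (segreEmbedding a b ℂ) 2 tK =
      complexBetti.map (fst (projectiveSpace a ℂ) (projectiveSpace b ℂ)) 2 ta +
        complexBetti.map (snd (projectiveSpace a ℂ) (projectiveSpace b ℂ)) 2 tb := by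
    rw [htK, map_ch_serreTwist_one_eq ch h_congr h_map (segreEmbedding a b ℂ),
      ch_serreTwist_segreEmbedding_one_eq ch h_congr h_map a b]
  have hpull : ∀ (u : X ⟶ projectiveSpace a ℂ) (u' : X ⟶ projectiveSpace b ℂ),
      complexBetti.map (lift u u' ≫ segreEmbedding a b ℂ) 2 tK =
        complexBetti.map u 2 ta + complexBetti.map u' 2 tb := by
    intro u u'
    rw [← complexBetti_map_map_apply, hσ, map_add, complexBetti_map_map_apply, complexBetti_map_map_apply, lift_fst,
      lift_snd]
  rw [hT, h1, h2, hΨ, hΦ, hpull ψ₁ ψ₂, hpull φ₁ φ₂]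
  abel

/-- **All degrees**: `chᵢ(L₁ ⊗ L₂) = (i!)⁻¹ (ch₁ L₁ + ch₁ L₂)ⁱ` for `i > 0` and `L₁`, `L₂` of rank one on a smooth projective variety
(the exponential law on the rank-one module `L₁ ⊗ L₂` and the tensor law in degree one).
[cite: Fulton1998, §15.1 (iii)] [cite: Hartshorne1977, II Ex. 6.11] -/
theorem ch_tensorObj_eq_of_hasRank_one_of_laws
    (h_congr : ∀ {X : SchemeOver ℂ} {E F : X.left.Modules} (_ : E ≅ F) (i : ℕ), ch X E i = ch X F i)
    (h_map : ∀ {X Y : SchemeOver ℂ} (f : Y ⟶ X) (E : X.left.Modules), IsVectorBundle E →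
      ∀ i : ℕ, complexBetti.map f (2 * i) (ch X E i) = ch Y ((Scheme.Modules.pullback f.left).obj E) i)
    (h_free : ∀ (X : SchemeOver ℂ) (I : Type) [Finite I] {i : ℕ}, 0 < i →
      ch X (SheafOfModules.free (R := X.left.ringCatSheaf) I) i = 0)
    (h_line : ∀ {X : SchemeOver ℂ} {L : X.left.Modules}, HasRankLE L 1 →
      ∀ {i : ℕ}, 0 < i → ch X L i = ((Nat.factorial i : ℕ) : ℂ)⁻¹ • cupPowTwo (ch X L 1) i)
    {n : ℕ} {X : SchemeOver ℂ} (hX : IsSmoothProjective n X) {L₁ L₂ : X.left.Modules} (hL₁ : HasRank L₁ 1)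
    (hL₂ : HasRank L₂ 1) {i : ℕ} (hi : 0 < i) :
    ch X (Modules.tensorObj L₁ L₂) i = ((Nat.factorial i : ℕ) : ℂ)⁻¹ • cupPowTwo (ch X L₁ 1 + ch X L₂ 1) i := by
  rw [h_line (Modules.hasRank_tensorObj_one hL₁ hL₂).hasRankLE hi,
    ch_one_tensorObj_eq_add_of_laws ch h_congr h_map h_free hX hL₁ hL₂]

/-- **The tensor law for a lawful datum** (bundled form): `ch₁(L₁ ⊗ L₂) = ch₁(L₁) + ch₁(L₂)` for modules of rank one on a smooth
projective variety. [cite: Fulton1998, §15.1 (iii) and Example 3.2.3] [cite: Hartshorne1977, II Ex. 5.11 and II Ex. 6.11] -/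
theorem ChernDatum.IsTopological.ch_one_tensorObj_eq_add {ch : ChernDatum} (h : ch.IsTopological) {n : ℕ} {X : SchemeOver ℂ}
    (hX : IsSmoothProjective n X) {L₁ L₂ : X.left.Modules} (hL₁ : HasRank L₁ 1) (hL₂ : HasRank L₂ 1) :
    ch X (Modules.tensorObj L₁ L₂) 1 = ch X L₁ 1 + ch X L₂ 1 :=
  ch_one_tensorObj_eq_add_of_laws ch h.ch_congr h.map_ch h.ch_free_of_pos hX hL₁ hL₂

/-- **All degrees, bundled**: `chᵢ(L₁ ⊗ L₂) = (i!)⁻¹ (ch₁ L₁ + ch₁ L₂)ⁱ` (`i > 0`). [cite: Fulton1998, §15.1 (iii)] -/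
theorem ChernDatum.IsTopological.ch_tensorObj_eq_of_hasRank_one {ch : ChernDatum} (h : ch.IsTopological) {n : ℕ}
    {X : SchemeOver ℂ} (hX : IsSmoothProjective n X) {L₁ L₂ : X.left.Modules} (hL₁ : HasRank L₁ 1) (hL₂ : HasRank L₂ 1) {i : ℕ}
    (hi : 0 < i) :
    ch X (Modules.tensorObj L₁ L₂) i = ((Nat.factorial i : ℕ) : ℂ)⁻¹ • cupPowTwo (ch X L₁ 1 + ch X L₂ 1) i :=
  ch_tensorObj_eq_of_hasRank_one_of_laws ch h.ch_congr h.map_ch h.ch_free_of_pos h.ch_of_hasRankLE_one hX hL₁ hL₂ hi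

/-! ### §3 The dual law -/

/-- **The dual law for `ch₁`**: `ch₁(L^∨) = −ch₁(L)` for a module `L` of rank one on a smooth projective variety — `𝒪 ≅ L^∨ ⊗ L`
(Stacks 0B8K), the tensor law, and `ch₁(𝒪) = 0`. [cite: Fulton1998, §15.1 (iii) and Example 3.2.3] [cite: Hartshorne1977, II Ex. 6.11] -/
theorem ch_one_dual_eq_neg_of_laws
    (h_congr : ∀ {X : SchemeOver ℂ} {E F : X.left.Modules} (_ : E ≅ F) (i : ℕ), ch X E i = ch X F i)
    (h_map : ∀ {X Y : SchemeOver ℂ} (f : Y ⟶ X) (E : X.left.Modules), IsVectorBundle E →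
      ∀ i : ℕ, complexBetti.map f (2 * i) (ch X E i) = ch Y ((Scheme.Modules.pullback f.left).obj E) i)
    (h_free : ∀ (X : SchemeOver ℂ) (I : Type) [Finite I] {i : ℕ}, 0 < i →
      ch X (SheafOfModules.free (R := X.left.ringCatSheaf) I) i = 0)
    {n : ℕ} {X : SchemeOver ℂ} (hX : IsSmoothProjective n X) {L : X.left.Modules} (hL : HasRank L 1) :
    ch X (Modules.dual L) 1 = -ch X L 1 := by
  obtain ⟨e⟩ := Modules.nonempty_free_punit_iso_tensorObj_dual (Modules.HasRank.isFiniteLocallyFree' hL) hL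
  have h := ch_one_tensorObj_eq_add_of_laws ch h_congr h_map h_free hX (Modules.hasRank_dual hL) hL
  rw [← h_congr e 1, h_free X PUnit one_pos] at h
  exact eq_neg_of_add_eq_zero_left h.symm

/-- **The dual law, bundled**: `ch₁(L^∨) = −ch₁(L)`. [cite: Fulton1998, §15.1 (iii)] -/
theorem ChernDatum.IsTopological.ch_one_dual_eq_neg {ch : ChernDatum} (h : ch.IsTopological) {n : ℕ} {X : SchemeOver ℂ}
    (hX : IsSmoothProjective n X) {L : X.left.Modules} (hL : HasRank L 1) : ch X (Modules.dual L) 1 = -ch X L 1 :=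
  ch_one_dual_eq_neg_of_laws ch h.ch_congr h.map_ch h.ch_free_of_pos hX hL

end HodgeTheory

end Literature.AlgebraicGeometry.HodgeTheory

end
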